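import Mathlib
import HarnessLib
import Summits.RiemannHypothesis.RiemannHypothesis.Theses.WeilWindowFlow
import Literature.NumberTheory.LFunctions.WeilExplicit
import Literature.NumberTheory.LFunctions.WeilDilationVirial
import Literature.NumberTheory.LFunctions.WeilGroundState
import Literature.NumberTheory.LFunctions.WeilWindowSuzukiContinuityProofs

/-!
# Triage scratch W1 — crux-triage r1-3, crux `DiniLeakage` (stmt-RiemannHypothesis-1038)

Card `spectral-virial-shadow`: its typed transfer target `VirialLeakage` (SketchIdeator2.lean,
copied verbatim below as `VirialLeakageAll`) quantifies over ALL `θ`-near-minimisers.  On paper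
(TRIAGE-r1-3.md §B) the dilation virial is UNBOUNDED ABOVE AND BELOW on every energy sublevel set
`{Q ≤ ε(a) + θ}` as soon as the window contains a prime power (`a > log 2 / 2`): high-frequency
contamination `ψ₀ + δ e^{iνt} b(t)` costs energy `δ²‖b‖² log ν` but carries prime virial
`δ² ν P(ν)`, `P` a non-zero mean-zero trigonometric polynomial.  We record that analytic fact as a
`Prop` (`VirialUnboundedOnSublevels`, not proved here) and prove the cheap logical consequences:
it kills the `∀`-form and makes the `∃`-form vacuous-true, so neither can be the line's stub.
-/

noncomputable section

open Set Filter MeasureTheory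
open scoped Real Topology

namespace TriageR13

open Literature.NumberTheory.LFunctions
open Summit.RiemannHypothesis.RiemannHypothesis.Theses.WeilWindowFlow

/-- Verbatim copy of `VirialLeakage` from `Cruxes/DiniLeakage/SketchIdeator2.lean` (card
`spectral-virial-shadow`, transfer target C⁺ ⟹ this ⟹ crux). -/
def VirialLeakageAll : Prop :=
  ∀ b₀ A : ℝ, 0 < b₀ → b₀ ≤ A → ∃ K : ℝ, ∀ a : ℝ, b₀ ≤ a → a ≤ A → ∀ η : ℝ, 0 < η →
    ∃ θ : ℝ, 0 < θ ∧ ∀ ψ : ℝ → ℂ, IsWeilTest ψ → tsupport ψ ⊆ Icc (-a) a →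
      ∫ t : ℝ, ‖ψ t‖ ^ 2 = 1 → (weilQuadratic ψ).re ≤ weilGroundEnergy a + θ →
        weilDilationVirial ψ ≤ a * (K * weilGroundEnergy a + η)

/-- The `∃`-form one might substitute (inf of the virial over near-minimisers is slaved to `ε`). -/
def VirialLeakageExists : Prop :=
  ∀ b₀ A : ℝ, 0 < b₀ → b₀ ≤ A → ∃ K : ℝ, 0 ≤ K ∧ ∀ a : ℝ, b₀ ≤ a → a ≤ A → ∀ η θ : ℝ, 0 < η → 0 < θ →
    ∃ ψ : ℝ → ℂ, IsWeilTest ψ ∧ tsupport ψ ⊆ Icc (-a) a ∧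
      ∫ t : ℝ, ‖ψ t‖ ^ 2 = 1 ∧ (weilQuadratic ψ).re ≤ weilGroundEnergy a + θ ∧
        weilDilationVirial ψ ≤ a * (K * weilGroundEnergy a + η)

/-- TRIAGE FINDING (paper proof in TRIAGE-r1-3.md §B; elementary: Riemann–Lebesgue for the polar
part, `u·∂ᵤRe ψ(1/4+iu/2)` bounded for the archimedean part, the prime virial of `e^{iνt}b` equals
`ν·P(ν) + O(1)` with `P(ν) = 2 Σ_{n<e^{2a}} Λ(n) n^{-1/2} log n (b⋆b̃)(log n) sin(ν log n)`):
beyond the dyadic window the virial is unbounded above AND below on every energy sublevel set of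
the unit sphere of the window. -/
def VirialUnboundedOnSublevels : Prop :=
  ∀ a : ℝ, Real.log 2 / 2 < a → ∀ θ : ℝ, 0 < θ → ∀ M : ℝ,
    (∃ ψ : ℝ → ℂ, IsWeilTest ψ ∧ tsupport ψ ⊆ Icc (-a) a ∧ ∫ t : ℝ, ‖ψ t‖ ^ 2 = 1 ∧
        (weilQuadratic ψ).re ≤ weilGroundEnergy a + θ ∧ M ≤ weilDilationVirial ψ) ∧
    (∃ ψ : ℝ → ℂ, IsWeilTest ψ ∧ tsupport ψ ⊆ Icc (-a) a ∧ ∫ t : ℝ, ‖ψ t‖ ^ 2 = 1 ∧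
        (weilQuadratic ψ).re ≤ weilGroundEnergy a + θ ∧ weilDilationVirial ψ ≤ M)

/-- The `∀`-form of the card's transfer target is refuted by the unboundedness fact: take the
one-point range `b₀ = A = a` with `a > log 2 / 2`. -/
theorem virialLeakageAll_false_of_unbounded (hU : VirialUnboundedOnSublevels) :
    ¬ VirialLeakageAll := by
  intro hV
  have hlog : (0 : ℝ) < Real.log 2 / 2 := div_pos (Real.log_pos one_lt_two) two_pos
  set a : ℝ := Real.log 2 / 2 + 1 with ha_def
  have ha : Real.log 2 / 2 < a := by simp [ha_def]
  have ha0 : 0 < a := hlog.trans ha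
  obtain ⟨K, hK⟩ := hV a a ha0 le_rfl
  obtain ⟨θ, hθ, hall⟩ := hK a le_rfl le_rfl 1 one_pos
  obtain ⟨⟨ψ, hψ, hsupp, hnorm, hQ, hM⟩, -⟩ :=
    hU a ha θ hθ (a * (K * weilGroundEnergy a + 1) + 1)
  have := hall ψ hψ hsupp hnorm hQ
  linarith

/-- … and the `∃`-form is satisfied for free (with `K = 0`) on every range beyond the dyadic
window, so it carries no information there either. -/
theorem virialLeakageExists_of_unbounded_beyond_dyadic (hU : VirialUnboundedOnSublevels)
    (b₀ A : ℝ) (hb : Real.log 2 / 2 < b₀) (_hbA : b₀ ≤ A) :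
    ∃ K : ℝ, 0 ≤ K ∧ ∀ a : ℝ, b₀ ≤ a → a ≤ A → ∀ η θ : ℝ, 0 < η → 0 < θ →
      ∃ ψ : ℝ → ℂ, IsWeilTest ψ ∧ tsupport ψ ⊆ Icc (-a) a ∧
        ∫ t : ℝ, ‖ψ t‖ ^ 2 = 1 ∧ (weilQuadratic ψ).re ≤ weilGroundEnergy a + θ ∧
          weilDilationVirial ψ ≤ a * (K * weilGroundEnergy a + η) := by
  refine ⟨0, le_rfl, fun a hba _ η θ hη hθ ↦ ?_⟩
  have ha : Real.log 2 / 2 < a := hb.trans_le hba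
  have ha0 : 0 < a := lt_trans (div_pos (Real.log_pos one_lt_two) two_pos) ha
  obtain ⟨-, ψ, hψ, hsupp, hnorm, hQ, hM⟩ := hU a ha θ hθ 0
  refine ⟨ψ, hψ, hsupp, hnorm, hQ, ?_⟩
  have : 0 ≤ a * (0 * weilGroundEnergy a + η) := by
    rw [zero_mul, zero_add]; exact (mul_pos ha0 hη).le
  linarith

/-- What the Hadamard step actually consumes (sharpened transfer shape, for crux-plan): a bound on
the DIFFERENCE QUOTIENT of the energy along Bombieri's dilation of some near-minimiser of the
LARGER window — by `weilQuadratic_weilDilate` this is one unfolding of the crux, so a line must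
put its content into WHICH near-minimiser (the true ground state) and WHY its dilation profile is
flat, not into the infinitesimal virial of arbitrary near-minimisers. -/
def DilationQuotientLeakage : Prop :=
  ∀ b₀ A : ℝ, 0 < b₀ → b₀ ≤ A → ∃ K : ℝ, 0 ≤ K ∧ ∀ a : ℝ, b₀ ≤ a → a ≤ A → ∀ η δ : ℝ, 0 < η → 0 < δ →
    ∃ h : ℝ, 0 < h ∧ h < δ ∧ ∀ θ : ℝ, 0 < θ → ∃ ψ : ℝ → ℂ, IsWeilTest ψ ∧
      tsupport ψ ⊆ Icc (-(a + h)) (a + h) ∧ ∫ t : ℝ, ‖ψ t‖ ^ 2 = 1 ∧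
      (weilQuadratic ψ).re ≤ weilGroundEnergy (a + h) + θ ∧
      (weilQuadratic (weilDilate (h / a) ψ)).re - (weilQuadratic ψ).re ≤ h * (K * weilGroundEnergy a + η)

/-- The sharpened shape implies the crux by the definition of `ε` alone (dilate lands in window
`a`, keeps the norm): one unfolding — which is exactly why it is bookkeeping, not a line. -/
theorem diniLeakage_of_dilationQuotientLeakage (h : DilationQuotientLeakage) : DiniLeakage := by
  intro b₀ A hb hbA
  obtain ⟨K, -, hK⟩ := h b₀ A hb hbA
  refine ⟨K, fun a hba haA η δ hη hδ ↦ ?_⟩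
  obtain ⟨h', hh', hh'δ, hmain⟩ := hK a hba haA (η / 2) δ (half_pos hη) hδ
  refine ⟨h', hh', hh'δ, ?_⟩
  have ha0 : 0 < a := hb.trans_le hba
  -- for every θ > 0: ε a ≤ Q(dilate) ≤ Q ψ + h'(Kε a + η/2) ≤ ε(a+h') + θ + h'(Kε a + η/2)
  have key : ∀ θ : ℝ, 0 < θ →
      weilGroundEnergy a ≤ weilGroundEnergy (a + h') + θ + h' * (K * weilGroundEnergy a + η / 2) := by
    intro θ hθ
    obtain ⟨ψ, hψ, hsupp, hnorm, hQ, hdq⟩ := hmain θ hθ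
    have hη' : (-1 : ℝ) < h' / a := by
      have : 0 < h' / a := div_pos hh' ha0
      linarith
    have hsupp' : tsupport (weilDilate (h' / a) ψ) ⊆ Icc (-a) a := by
      have hs := tsupport_weilDilate_subset ψ hη' hsupp
      have hscale : (a + h') / (1 + h' / a) = a := by
        field_simp
      simpa [hscale] using hs
    have hnorm' : ∫ t : ℝ, ‖weilDilate (h' / a) ψ t‖ ^ 2 = 1 := by
      rw [integral_norm_sq_weilDilate ψ hη', hnorm]
    have hle : weilGroundEnergy a ≤ (weilQuadratic (weilDilate (h' / a) ψ)).re :=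
      weilGroundEnergy_le_re_weilQuadratic (hψ.weilDilate hη') hsupp' hnorm'
    linarith
  -- let θ → 0
  have : weilGroundEnergy a ≤ weilGroundEnergy (a + h') + h' * (K * weilGroundEnergy a + η / 2) := by
    refine le_of_forall_pos_lt_add fun θ hθ ↦ ?_
    have := key (θ / 2) (half_pos hθ)
    linarith
  nlinarith [mul_pos hh' hη]

end TriageR13

end
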